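import Literature.NumberTheory.NumberFields.RelativeSquareClasses
import Literature.NumberTheory.Automorphic.GaloisActionPlaces
import Mathlib.NumberTheory.NumberField.CMField
import HarnessLib

/-!
# A CM field has infinitely many rational primes `ℓ` below a degree-one prime `𝔏` that is
# split over the maximal real subfield (`c𝔏 ≠ 𝔏`, `e(𝔏|ℓ) = f(𝔏|ℓ) = 1`)

Topic `NumberTheory/NumberFields`; namespace `Literature.NumberTheory.NumberFields`. Theorems only
(no definition, no named fact), all fully proved.

For a CM field `K` (Mathlib `NumberField.IsCMField K`, complex conjugation
`c = IsCMField.complexConj K ∈ Gal(K/K⁺)`, `K⁺ = maximalRealSubfield K`) and a rational prime `ℓ`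
that SPLITS COMPLETELY in `K` (`GaloisRepresentations.SplitsCompletely K ℓ`: unramified, every
place above `ℓ` of residue degree one):

* `IsCMField.exists_place_complexConj_smul_ne_of_splitsCompletely` — there is a place `𝔏 ∣ ℓ` of
  `K` with `c • 𝔏 ≠ 𝔏` and `e(𝔏|ℓ) = f(𝔏|ℓ) = 1`. Proof: `[K : ℚ] = 2[K⁺ : ℚ] > [K⁺ : ℚ]`, so by
  the tree's pigeonhole `exists_two_primes_over_one` (Marcus, *Number Fields*, Ch. 4, before
  Thm. 29) two distinct places `𝔏₁ ≠ 𝔏₂` of `K` above `ℓ` lie over ONE place of `K⁺`; `K/K⁺` is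
  Galois with group `{1, c}` acting transitively on that fibre (Mathlib
  `Ideal.exists_smul_eq_of_isGaloisGroup`, through the tree's `HeightOneSpectrum.exists_algEquiv_smul_eq`),
  so `c • 𝔏₁ = 𝔏₂ ≠ 𝔏₁`; `e = f = 1` is the definition of complete splitting
  (`splitsCompletely_iff_forall_ramificationIdx_eq_one_and_inertiaDeg_eq_one`).
* `IsCMField.exists_prime_split_degreeOne` — **for every finite set `S` of natural numbers there
  is a prime `ℓ ∉ S` and a place `𝔏 ∣ ℓ` of `K` with `c • 𝔏 ≠ 𝔏`, `e(𝔏|ℓ) = f(𝔏|ℓ) = 1`**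
  (infinitely many `ℓ` split completely: the tree's Chebotarev-based
  `infinite_setOf_splitsCompletely`); `IsCMField.infinite_setOf_prime_split_degreeOne` is the
  same as an infinitude statement.

This is the AUXILIARY PRIME `𝔩 = 𝔏 ∩ K⁺` ("`𝔩 ∤ p` a prime of `F = K⁺` that splits in `K`, with
`F_𝔩 = ℚ_ℓ`", i.e. the `ℤ_ℓ`-rank-one anticyclotomic direction) presumed by the non-vanishing
theorems for anticyclotomic twists of Hecke `L`-values over CM fields typed in
`EllipticCurves/Hsieh2012/NonvanishingHeckeLValuesModP.lean` (Hsieh, Amer. J. Math. 134 (2012),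
Thm. A: "`𝔩` splits in `K`", regime `dim_{ℚ_ℓ} F_𝔩 = 1`) and
`EllipticCurves/HeWei2025/PStabilityHeckeLValues.lean` (He, Math. Ann. 392 (2025), Thm. 1.4 (2)):
their binders `((ℓ : ℕ) : 𝓞 K) ∈ 𝔏.asIdeal`, `IsCMField.complexConj K • 𝔏 ≠ 𝔏`,
`𝔏.asIdeal.ramificationIdx ℤ = 1`, `𝔏.asIdeal.inertiaDeg ℤ = 1` are supplied here verbatim, away
from any prescribed finite set of primes (the residue characteristic `p` and the primes below
the conductor of the character).

## References

* D. A. Marcus, *Number Fields*, 2nd ed. (2018), Ch. 4 (before Thm. 29: primes splitting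
  completely; pigeonhole over an intermediate field). [Marcus2018]
* J. Neukirch, *Algebraic Number Theory* (1999), Ch. I (9.1)–(9.4) (transitivity of the Galois
  group on the primes above a prime; decomposition groups). [NeukirchANT1999]
* M.-L. Hsieh, Amer. J. Math. 134 (2012) 1503–1539, Thm. A (the auxiliary split prime `𝔩`).
  [Hsieh2012]
-/

noncomputable section

open scoped NumberField Classical
open NumberField IsDedekindDomain Ideal

namespace Literature.NumberTheory.NumberFields

open Literature.NumberTheory.GaloisRepresentations Literature.NumberTheory.Automorphic

variable (K : Type) [Field K] [NumberField K] [IsCMField K]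

/-- `[K⁺ : ℚ] < [K : ℚ]` for a CM field `K` (`[K : K⁺] = 2`). [cite: NeukirchANT1999, Ch. I §2 (degree in towers)] -/
theorem IsCMField.finrank_maximalRealSubfield_lt :
    Module.finrank ℚ (maximalRealSubfield K) < Module.finrank ℚ K := by
  have h2 : Module.finrank (maximalRealSubfield K) K = 2 :=
    Algebra.IsQuadraticExtension.finrank_eq_two (maximalRealSubfield K) K
  have htower := Module.finrank_mul_finrank ℚ (maximalRealSubfield K) K
  have hpos : 0 < Module.finrank ℚ (maximalRealSubfield K) := Module.finrank_pos
  rw [h2] at htower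
  omega

/-- A nontrivial element of `Gal(K/K⁺)` is the complex conjugation (the group is `{1, c}`, Mathlib
`IsCMField.zpowers_complexConj_eq_top`, `orderOf_complexConj`). The tree has the same fact inside
the central-simple-algebra hierarchy (`Literature.RingTheory.CentralSimple.algEquiv_eq_complexConj_of_ne_one`,
`AntiInvolutionSecondKind.lean`); re-proved here in eight lines to keep `NumberFields` free of that
import. [cite: NeukirchANT1999, Ch. I §2] -/
theorem IsCMField.eq_complexConj_of_ne_one {σ : K ≃ₐ[maximalRealSubfield K] K} (hσ : σ ≠ 1) :
    σ = IsCMField.complexConj K := by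
  have hmem : σ ∈ Subgroup.zpowers (IsCMField.complexConj K) := by
    rw [IsCMField.zpowers_complexConj_eq_top]; exact Subgroup.mem_top σ
  obtain ⟨k, hk⟩ := Subgroup.mem_zpowers_iff.mp hmem
  rw [← zpow_mod_orderOf, IsCMField.orderOf_complexConj] at hk
  rcases Int.emod_two_eq_zero_or_one k with h0 | h1
  · rw [show (k % (2 : ℕ) : ℤ) = k % 2 from rfl, h0, zpow_zero] at hk
    exact absurd hk.symm hσ
  · rw [show (k % (2 : ℕ) : ℤ) = k % 2 from rfl, h1, zpow_one] at hk
    exact hk.symm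

omit [IsCMField K] in
/-- A place `𝔏` of `K` containing the rational prime `ℓ` lies over `(ℓ) ⊂ ℤ`.
[cite: NeukirchANT1999, Ch. I §8 (8.2)–(8.3)] -/
theorem liesOver_span_int_of_natCast_mem (𝔏 : HeightOneSpectrum (𝓞 K)) {ℓ : ℕ} (hℓ : ℓ.Prime)
    (h𝔏 : ((ℓ : ℕ) : 𝓞 K) ∈ 𝔏.asIdeal) : 𝔏.asIdeal.LiesOver (Ideal.span {(ℓ : ℤ)}) := by
  refine ⟨?_⟩
  haveI := 𝔏.isMaximal
  have hmax : (Ideal.span {(ℓ : ℤ)}).IsMaximal :=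
    Ideal.IsPrime.isMaximal
      (by
        rw [Ideal.span_singleton_prime (by exact_mod_cast hℓ.ne_zero)]
        exact_mod_cast Nat.prime_iff_prime_int.mp hℓ)
      (by simp [hℓ.ne_zero])
  refine hmax.eq_of_le (Ideal.comap_ne_top _ (Ideal.IsMaximal.ne_top inferInstance)) ?_
  rw [Ideal.span_singleton_le_iff_mem, Ideal.mem_comap, map_natCast]
  exact h𝔏

/-- **Above a completely split `ℓ`, some place `𝔏 ∣ ℓ` of the CM field `K` has `c • 𝔏 ≠ 𝔏` and
`e(𝔏|ℓ) = f(𝔏|ℓ) = 1`** (indeed every place above `ℓ` does; one suffices for the consumers).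
Pigeonhole over `K⁺` (`exists_two_primes_over_one`) + transitivity of `Gal(K/K⁺) = {1, c}` on the
fibre. [cite: Marcus2018, Ch. 4 (before Thm. 29)] [cite: NeukirchANT1999, Ch. I (9.1)] -/
theorem IsCMField.exists_place_complexConj_smul_ne_of_splitsCompletely {ℓ : ℕ} (hℓ : ℓ.Prime)
    (hsplit : SplitsCompletely K ℓ) :
    ∃ 𝔏 : HeightOneSpectrum (𝓞 K), ((ℓ : ℕ) : 𝓞 K) ∈ 𝔏.asIdeal ∧
      IsCMField.complexConj K • 𝔏 ≠ 𝔏 ∧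
      𝔏.asIdeal.ramificationIdx ℤ = 1 ∧ 𝔏.asIdeal.inertiaDeg ℤ = 1 := by
  obtain ⟨v, w₁, w₂, hne, h₁, -, hov₁, hov₂, -, -⟩ :=
    exists_two_primes_over_one (K := maximalRealSubfield K) (E := K)
      (IsCMField.finrank_maximalRealSubfield_lt K) hℓ hsplit
  -- the two places lie over the same place of `K⁺`, hence are `Gal(K/K⁺)`-conjugate
  have hunder : w₁.under (𝓞 (maximalRealSubfield K)) = w₂.under (𝓞 (maximalRealSubfield K)) := by
    rw [HeightOneSpectrum.ext_iff, HeightOneSpectrum.under_asIdeal, HeightOneSpectrum.under_asIdeal,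
      ← hov₁.over, ← hov₂.over]
  obtain ⟨σ, hσ⟩ := HeightOneSpectrum.exists_algEquiv_smul_eq (maximalRealSubfield K) hunder
  have hσ1 : σ ≠ 1 := by
    rintro rfl
    exact hne (by simpa using hσ)
  have hσc : σ = IsCMField.complexConj K := IsCMField.eq_complexConj_of_ne_one K hσ1
  -- `e = f = 1` from complete splitting
  haveI : w₁.asIdeal.LiesOver (Ideal.span {(ℓ : ℤ)}) := liesOver_span_int_of_natCast_mem K w₁ hℓ h₁
  have hef := (splitsCompletely_iff_forall_ramificationIdx_eq_one_and_inertiaDeg_eq_one hℓ).mp hsplit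
    w₁.asIdeal ⟨w₁.isPrime, inferInstance⟩
  refine ⟨w₁, h₁, ?_, hef.1, hef.2⟩
  rw [← hσc, hσ]
  exact hne.symm

/-- **The auxiliary split prime of a CM field, away from a finite set.** For every finite set `S`
of natural numbers there are a prime `ℓ ∉ S` and a place `𝔏 ∣ ℓ` of `K` with `c • 𝔏 ≠ 𝔏` (the
prime `𝔩 = 𝔏 ∩ K⁺` splits in `K`) and `e(𝔏|ℓ) = f(𝔏|ℓ) = 1` (`K_𝔏 = F_𝔩 = ℚ_ℓ`): the binders
"`𝔩 ∤ p`, `𝔩` splits in `K`, `dim_{ℚ_ℓ} F_𝔩 = 1`" of the anticyclotomic non-vanishing theorems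
(`Hsieh2012.thmA_NV_of_isSelfDual`, `HeWei2025.thm14_NVInfinite_of_isSelfDual`), verbatim. From the
tree's Chebotarev-based `infinite_setOf_splitsCompletely`. [cite: Hsieh2012, Theorem A (p. 2: "`𝔩` splits in `K`", "dim_{ℚ_ℓ} F_𝔩 = 1")] [cite: Marcus2018, Ch. 4 (before Thm. 29)] -/
theorem IsCMField.exists_prime_split_degreeOne {S : Set ℕ} (hS : S.Finite) :
    ∃ ℓ : ℕ, ℓ.Prime ∧ ℓ ∉ S ∧ ∃ 𝔏 : HeightOneSpectrum (𝓞 K), ((ℓ : ℕ) : 𝓞 K) ∈ 𝔏.asIdeal ∧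
      IsCMField.complexConj K • 𝔏 ≠ 𝔏 ∧
      𝔏.asIdeal.ramificationIdx ℤ = 1 ∧ 𝔏.asIdeal.inertiaDeg ℤ = 1 := by
  obtain ⟨ℓ, ⟨hℓ, hsplit⟩, hℓS⟩ := ((infinite_setOf_splitsCompletely (L := K)).sdiff hS).nonempty
  exact ⟨ℓ, hℓ, hℓS, IsCMField.exists_place_complexConj_smul_ne_of_splitsCompletely K hℓ hsplit⟩

/-- The same as an infinitude statement: infinitely many primes `ℓ` lie below a degree-one place of
`K` split over `K⁺`. [cite: Marcus2018, Ch. 4 (before Thm. 29)] -/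
theorem IsCMField.infinite_setOf_prime_split_degreeOne :
    {ℓ : ℕ | ℓ.Prime ∧ ∃ 𝔏 : HeightOneSpectrum (𝓞 K), ((ℓ : ℕ) : 𝓞 K) ∈ 𝔏.asIdeal ∧
      IsCMField.complexConj K • 𝔏 ≠ 𝔏 ∧
      𝔏.asIdeal.ramificationIdx ℤ = 1 ∧ 𝔏.asIdeal.inertiaDeg ℤ = 1}.Infinite :=
  (infinite_setOf_splitsCompletely (L := K)).mono fun _ h ↦
    ⟨h.1, IsCMField.exists_place_complexConj_smul_ne_of_splitsCompletely K h.1 h.2⟩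

/-- Variant with two avoided data, as the consumers meet it: a prime `ℓ ≠ p` not dividing a given
natural number `N ≠ 0` (e.g. the absolute norm of a conductor), below a degree-one place split over
`K⁺`. [cite: Hsieh2012, Theorem A (p. 2) and §6.1 ("`(p𝔩, D_{K/F}C) = 1`")] -/
theorem IsCMField.exists_prime_split_degreeOne_not_dvd (p N : ℕ) (hN : N ≠ 0) :
    ∃ ℓ : ℕ, ℓ.Prime ∧ ℓ ≠ p ∧ ¬ ℓ ∣ N ∧ ∃ 𝔏 : HeightOneSpectrum (𝓞 K),
      ((ℓ : ℕ) : 𝓞 K) ∈ 𝔏.asIdeal ∧ IsCMField.complexConj K • 𝔏 ≠ 𝔏 ∧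
      𝔏.asIdeal.ramificationIdx ℤ = 1 ∧ 𝔏.asIdeal.inertiaDeg ℤ = 1 := by
  have hfin : (({p} : Set ℕ) ∪ (N.divisors : Set ℕ)).Finite :=
    (Set.finite_singleton p).union N.divisors.finite_toSet
  obtain ⟨ℓ, hℓ, hℓS, h𝔏⟩ := IsCMField.exists_prime_split_degreeOne K hfin
  refine ⟨ℓ, hℓ, ?_, ?_, h𝔏⟩
  · exact fun h ↦ hℓS (Or.inl h)
  · intro hdvd
    exact hℓS (Or.inr (Finset.mem_coe.mpr (Nat.mem_divisors.mpr ⟨hdvd, hN⟩)))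

end Literature.NumberTheory.NumberFields

end
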